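import Literature.NumberTheory.LFunctions.SuzukiWeilModelSpace
import Literature.NumberTheory.LFunctions.SuzukiWeilChainBlaschkeProofs
import Literature.Analysis.DeBrangesSpaces.HardyPaleyWiener
import HarnessLib

/-!
# Blaschke factors on `𝖥L²(t,∞)`: Suzuki's `f_w`, `g_w` in the proof of CJM Thm. 5.7 (dB3)

LINE 1 — LABEL: RH-FREE theorems (no `RiemannHypothesis` anywhere) serving the «Assume RH» statement
CJM Thm. 5.7 (`Suzuki2025_thm57`, axiom (dB3) for the chain `E𝖥(V(t))`) of the cell rh-crit/dbl
(M. Suzuki, Canad. J. Math. 2025 = arXiv:2301.00421v3). bears_on: B-C/B-P (LADDER-RH COLUMN 6 DBR).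
WHAT THIS IS NOT: RH-free half-plane Paley–Wiener bookkeeping; nothing here bears on the truth of RH.

## What is proved (RH-FREE)

For `f ∈ L²(t,∞)` (`t ≥ 0`) and a non-real `w`, the function `((z − w̄)/(z − w))·f̂(z)` on `ℂ₊` is
again the half-plane transform `ĥ` of some `h ∈ L²(t,∞)` — when `Im w < 0` with no condition
(`exists_mem_halfLineL2_upperHalfHat_eq_blaschke_mul_of_im_neg`; printed `g_w`), and when
`Im w > 0` provided `f̂(w) = 0` (printed `f_w`; in §C). Suzuki writes `f_w`, `g_w` as Volterra
integrals ("we easily find that `f_w ∈ L²(t,∞)`"); here they are obtained from the tree's general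
Paley–Wiener theorem for `H²(ℂ₊)` (`exists_halfLine_laplace_of_hardy`, Rudin Thm. 19.2) applied to
`e^{−itz}·((z − w̄)/(z − w))·f̂(z)` and a shift by `t` (`exists_mem_halfLineL2_upperHalfHat_eq`), the
Hardy bound coming from `∫_ℝ|f̂(x+iy)|²dx ≤ 2πe^{−2yt}‖f‖²` (`integral_norm_sq_upperHalfHat_line_le`).
No definition and no named fact is introduced.

## References
* M. Suzuki, Canad. J. Math. 2025 = arXiv:2301.00421v3, Thm. 5.7 p. 16, proof of (dB3)
  (TeX l.1928–1946: `f_w`, `g_w`). [Suzuki2025WeilHilbertSpace]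
* W. Rudin, *Real and complex analysis*, Thm. 19.2. [Rudin1987]
-/

noncomputable section

open MeasureTheory Complex Filter Set Metric
open scoped ComplexConjugate Topology Real ENNReal

namespace Literature.NumberTheory.LFunctions

open Literature.Analysis.DeBrangesSpaces

/-! ## A. `L²` bounds for `f̂` on horizontal lines -/

/-- `x ↦ f̂(x + iy)` is square-integrable for `f ∈ L²(ℝ)`, `y > 0` (it is the class
`𝖥[1_{(0,∞)}f·e^{−y·}]`). RH-FREE. [cite: Suzuki2025WeilHilbertSpace, CJM §2.3 p. 5 (TeX l.615–619: "H² … boundary values")] -/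
theorem memLp_upperHalfHat_line (f : Lp ℂ 2 (volume : Measure ℝ)) {y : ℝ} (hy : 0 < y) :
    MemLp (fun x : ℝ ↦ upperHalfHat f ((x : ℂ) + y * I)) 2 volume := by
  refine (Lp.memLp (suzukiFourierL2 ((memLp_two_indicator_mul_exp f hy.le).toLp _))).ae_eq
    ((suzukiFourierL2_indicator_mul_exp_ae_eq f hy).mono fun x hx ↦ ?_)
  rw [hx, mul_comm I]

/-- **`∫_ℝ |f̂(x+iy)|² dx ≤ 2π·(e^{−yt}‖f‖)²` for `f ∈ L²(t,∞)`, `t ≥ 0`, `y > 0`** (Plancherel for the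
damped function `1_{(0,∞)}f·e^{−y·}`, which is bounded by `e^{−yt}|f|`). RH-FREE.
[cite: Suzuki2025WeilHilbertSpace, CJM §2.3 p. 5 and Thm. 5.7 proof p. 16 (TeX l.1905–1907: "Φ(z) = E(z)∫_t^∞ f(x)e^{izx}dx")] -/
theorem integral_norm_sq_upperHalfHat_line_le {f : Lp ℂ 2 (volume : Measure ℝ)} {t : ℝ}
    (hf : f ∈ halfLineL2 t) {y : ℝ} (hy : 0 < y) :
    ∫ x : ℝ, ‖upperHalfHat f ((x : ℂ) + y * I)‖ ^ 2 ≤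
      2 * Real.pi * (Real.exp (-(y * t)) * ‖f‖) ^ 2 := by
  set g : Lp ℂ 2 (volume : Measure ℝ) := (memLp_two_indicator_mul_exp f hy.le).toLp _ with hg
  have h1 : ∫ x : ℝ, ‖upperHalfHat f ((x : ℂ) + y * I)‖ ^ 2 = ‖suzukiFourierL2 g‖ ^ 2 := by
    rw [SuzukiOrthogonalSet.norm_sq_eq_integral_norm_sq]
    refine integral_congr_ae ((suzukiFourierL2_indicator_mul_exp_ae_eq f hy).mono fun x hx ↦ ?_)
    simp only
    rw [hx, mul_comm I]
  have h2 : ‖g‖ ≤ Real.exp (-(y * t)) * ‖f‖ := by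
    refine Lp.norm_le_mul_norm_of_ae_le_mul ?_
    filter_upwards [(memLp_two_indicator_mul_exp f hy.le).coeFn_toLp, hf] with s hs hfs
    rw [hs]
    by_cases hst : s < t
    · have h0 : (Ioi (0 : ℝ)).indicator (f : ℝ → ℂ) s = 0 := by
        rw [Set.indicator_apply_eq_zero]
        exact fun _ ↦ hfs hst
      rw [h0, zero_mul, norm_zero]
      positivity
    · have hst' : t ≤ s := not_lt.1 hst
      rw [norm_mul, Complex.norm_real, Real.norm_of_nonneg (Real.exp_nonneg _), mul_comm]
      exact mul_le_mul (Real.exp_le_exp.2 (by nlinarith)) (norm_indicator_le_norm_self _ _)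
        (norm_nonneg _) (Real.exp_nonneg _)
  rw [h1, norm_sq_suzukiFourierL2]
  have h3 : ‖g‖ ^ 2 ≤ (Real.exp (-(y * t)) * ‖f‖) ^ 2 := pow_le_pow_left₀ (norm_nonneg _) h2 2
  nlinarith [Real.pi_pos]

/-! ## B. The shift engine: `e^{−itz}G ∈ H²` gives `G = ĥ` with `h ∈ L²(t,∞)` -/

/-- **Paley–Wiener with support in `[t,∞)`**: if `G` is holomorphic on `ℂ₊` and `e^{−itz}G(z)` has
uniformly bounded `L²` norms on horizontal lines, then `G = ĥ` on `ℂ₊` for some `h ∈ L²(ℝ)`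
vanishing a.e. on `(−∞,t)` (`t ≥ 0`): the tree's general Paley–Wiener theorem for `e^{−itz}G`
and the shift `x ↦ x − t`. RH-FREE.
[cite: Rudin1987, Thm. 19.2; Suzuki2025WeilHilbertSpace, CJM Thm. 5.7 proof p. 16 (TeX l.1932–1934: "f_w ∈ L²(t,∞) and (𝖥f_w)(z) = …")] -/
theorem exists_mem_halfLineL2_upperHalfHat_eq {G : ℂ → ℂ} {t M : ℝ} (ht : 0 ≤ t) (hM0 : 0 ≤ M)
    (hd : DifferentiableOn ℂ G {z : ℂ | 0 < z.im})
    (h2 : ∀ y : ℝ, 0 < y →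
      Integrable (fun x : ℝ ↦ ‖cexp (-(I * t * (x + y * I))) * G (x + y * I)‖ ^ 2))
    (hM : ∀ y : ℝ, 0 < y →
      ∫ x : ℝ, ‖cexp (-(I * t * (x + y * I))) * G (x + y * I)‖ ^ 2 ≤ M ^ 2) :
    ∃ h : Lp ℂ 2 (volume : Measure ℝ), h ∈ halfLineL2 t ∧
      ∀ z : ℂ, 0 < z.im → upperHalfHat h z = G z := by
  set G' : ℂ → ℂ := fun z ↦ cexp (-(I * t * z)) * G z with hG'
  have hd' : DifferentiableOn ℂ G' {z : ℂ | 0 < z.im} :=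
    ((differentiable_const _).mul differentiable_id).neg.cexp.differentiableOn.mul hd
  obtain ⟨ψ, hψ2, hψ0, -, hψG⟩ := exists_halfLine_laplace_of_hardy hd' h2 hM hM0
  have hmp : MeasurePreserving (fun x : ℝ ↦ x - t) volume volume :=
    measurePreserving_sub_right volume t
  have hh2 : MemLp (fun x : ℝ ↦ ψ (x - t)) 2 volume := hψ2.comp_measurePreserving hmp
  have hψ0' : ∀ᵐ x : ℝ, x - t < 0 → ψ (x - t) = 0 := hmp.quasiMeasurePreserving.ae hψ0
  refine ⟨hh2.toLp _, ?_, fun z hz ↦ ?_⟩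
  · show ∀ᵐ x : ℝ, x < t → (hh2.toLp _ : ℝ → ℂ) x = 0
    filter_upwards [hh2.coeFn_toLp, hψ0'] with x hx h0
    intro hxt
    rw [hx]
    exact h0 (by linarith)
  · -- `ĥ(z) = ∫₀^∞ ψ(x − t)e^{izx}dx = e^{izt}∫₀^∞ ψ(u)e^{izu}du = e^{izt}·e^{−izt}G(z)`
    have h00 : ∀ᵐ x : ℝ, x ≠ 0 := by
      have : ({0}ᶜ : Set ℝ) ∈ ae (volume : Measure ℝ) := by
        rw [compl_mem_ae_iff, measure_singleton]
      exact this
    have e1 : upperHalfHat (hh2.toLp _ : Lp ℂ 2 (volume : Measure ℝ)) z =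
        ∫ x in Ioi (0 : ℝ), ψ (x - t) * cexp (I * z * x) := by
      unfold upperHalfHat
      refine integral_congr_ae ?_
      filter_upwards [ae_restrict_of_ae hh2.coeFn_toLp] with x hx
      rw [hx]
    have e2 : ∫ x in Ioi (0 : ℝ), ψ (x - t) * cexp (I * z * x) =
        ∫ x : ℝ, ψ (x - t) * cexp (I * z * x) := by
      refine setIntegral_eq_integral_of_ae_compl_eq_zero ?_
      filter_upwards [hψ0', h00] with x h0 hx0 hx
      rw [mem_Ioi, not_lt] at hx
      rw [h0 (by rcases hx.lt_or_eq with h | h <;> [linarith; exact absurd h hx0]), zero_mul]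
    have e3 : ∫ x : ℝ, ψ (x - t) * cexp (I * z * x) =
        cexp (I * z * t) * ∫ u : ℝ, ψ u * cexp (I * z * u) := by
      have hfun : (fun x : ℝ ↦ ψ (x - t) * cexp (I * z * x)) =
          fun x : ℝ ↦ (fun u : ℝ ↦ ψ u * cexp (I * z * u) * cexp (I * z * t)) (x - t) := by
        funext x
        simp only [mul_assoc, ← Complex.exp_add]
        congr 2
        push_cast
        ring
      rw [hfun, integral_sub_right_eq_self (fun u : ℝ ↦ ψ u * cexp (I * z * u) * cexp (I * z * t)) t,
        integral_mul_const, mul_comm]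
    have e4 : ∫ u : ℝ, ψ u * cexp (I * z * u) = ∫ u in Ioi (0 : ℝ), ψ u * cexp (I * z * u) := by
      refine (setIntegral_eq_integral_of_ae_compl_eq_zero ?_).symm
      filter_upwards [hψ0, h00] with u h0 hu0 hu
      rw [mem_Ioi, not_lt] at hu
      rw [h0 (lt_of_le_of_ne hu hu0), zero_mul]
    rw [e1, e2, e3, e4, hψG z hz, hG']
    simp only
    rw [← mul_assoc, ← Complex.exp_add, show I * z * (t : ℂ) + -(I * t * z) = 0 by ring,
      Complex.exp_zero, one_mul]

/-! ## C. The Blaschke factor with pole in the lower half-plane (Suzuki's `g_w`) -/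

/-- `|(z − w̄)/(z − w)| ≤ 1` for `Im z > 0 > Im w`. [folklore] -/
private theorem norm_blaschke_le_one {z w : ℂ} (hz : 0 < z.im) (hw : w.im < 0) :
    ‖(z - conj w) / (z - w)‖ ≤ 1 := by
  have hzw : z - w ≠ 0 := fun h ↦ by
    have := congrArg Complex.im h
    simp only [Complex.sub_im, Complex.zero_im] at this
    linarith
  rw [norm_div, div_le_one (norm_pos_iff.2 hzw)]
  have h1 : ‖z - conj w‖ ^ 2 ≤ ‖z - w‖ ^ 2 := by
    rw [Complex.sq_norm, Complex.sq_norm, Complex.normSq_apply, Complex.normSq_apply]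
    simp only [Complex.sub_re, Complex.sub_im, Complex.conj_re, Complex.conj_im]
    nlinarith
  exact le_of_pow_le_pow_left₀ two_ne_zero (norm_nonneg _) h1

/-- **Suzuki's `g_w` (CJM Thm. 5.7, proof of (dB3)) via Paley–Wiener**: for `f ∈ L²(t,∞)`, `t ≥ 0`,
and `Im w < 0`, there is `h ∈ L²(t,∞)` with `ĥ(z) = ((z − w̄)/(z − w))·f̂(z)` on `ℂ₊` (the Blaschke
factor with pole in `ℂ₋` is bounded by `1` on `ℂ₊`, so `e^{−itz}((z − w̄)/(z − w))f̂(z)` has the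
Hardy bound `2π‖f‖²`). RH-FREE.
[cite: Suzuki2025WeilHilbertSpace, CJM Thm. 5.7 p. 16, proof of (dB3) (TeX l.1940–1946: "g_w has support in [t,∞) … (𝖥g_w)(z) = ((z−w)/(z−w̄))(𝖥𝖪f)(z)")] -/
theorem exists_mem_halfLineL2_upperHalfHat_eq_blaschke_mul_of_im_neg
    {f : Lp ℂ 2 (volume : Measure ℝ)} {t : ℝ} (ht : 0 ≤ t) (hf : f ∈ halfLineL2 t)
    {w : ℂ} (hw : w.im < 0) :
    ∃ h : Lp ℂ 2 (volume : Measure ℝ), h ∈ halfLineL2 t ∧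
      ∀ z : ℂ, 0 < z.im → upperHalfHat h z = (z - conj w) / (z - w) * upperHalfHat f z := by
  set G : ℂ → ℂ := fun z ↦ (z - conj w) / (z - w) * upperHalfHat f z with hG
  have hBd : DifferentiableOn ℂ (fun z : ℂ ↦ (z - conj w) / (z - w)) {z : ℂ | 0 < z.im} := by
    refine DifferentiableOn.div (by fun_prop) (by fun_prop) fun z hz ↦ ?_
    refine sub_ne_zero.2 fun h ↦ ?_
    rw [h] at hz
    exact absurd hz (not_lt.2 hw.le)
  have hd : DifferentiableOn ℂ G {z : ℂ | 0 < z.im} := hBd.mul (differentiableOn_upperHalfHat f)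
  set G' : ℂ → ℂ := fun z ↦ cexp (-(I * t * z)) * G z with hG'
  have hd' : DifferentiableOn ℂ G' {z : ℂ | 0 < z.im} :=
    ((differentiable_const _).mul differentiable_id).neg.cexp.differentiableOn.mul hd
  have him : ∀ (x y : ℝ), 0 < y → 0 < ((x : ℂ) + y * I).im := fun x y hy ↦ by simp [hy]
  -- pointwise bound on horizontal lines
  have hpt : ∀ y : ℝ, 0 < y → ∀ x : ℝ,
      ‖cexp (-(I * t * (x + y * I))) * G (x + y * I)‖ ^ 2 ≤
        Real.exp (y * t) ^ 2 * ‖upperHalfHat f (x + y * I)‖ ^ 2 := by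
    intro y hy x
    rw [norm_mul, hG, norm_mul, mul_pow, mul_pow, Complex.norm_exp]
    have hre : (-(I * (t : ℂ) * ((x : ℂ) + (y : ℂ) * I))).re = y * t := by
      simp only [Complex.neg_re, Complex.mul_re, Complex.mul_im, Complex.I_re, Complex.I_im,
        Complex.ofReal_re, Complex.ofReal_im, Complex.add_re, Complex.add_im]
      ring
    rw [hre]
    have hB : ‖((x : ℂ) + y * I - conj w) / ((x : ℂ) + y * I - w)‖ ^ 2 ≤ 1 :=
      pow_le_one₀ (norm_nonneg _) (norm_blaschke_le_one (him x y hy) hw)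
    exact mul_le_mul_of_nonneg_left (mul_le_of_le_one_left (sq_nonneg _) hB) (sq_nonneg _)
  -- integrability on horizontal lines
  have hcont : ∀ y : ℝ, 0 < y →
      Continuous fun x : ℝ ↦ cexp (-(I * t * (x + y * I))) * G (x + y * I) := by
    intro y hy
    have hline : Continuous fun x : ℝ ↦ ((x : ℂ) + y * I) := by fun_prop
    exact hd'.continuousOn.comp_continuous hline fun x ↦ him x y hy
  have hint : ∀ y : ℝ, 0 < y → Integrable fun x : ℝ ↦ ‖upperHalfHat f (x + y * I)‖ ^ 2 :=
    fun y hy ↦ (memLp_two_iff_integrable_sq_norm (memLp_upperHalfHat_line f hy).1).1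
      (memLp_upperHalfHat_line f hy)
  have h2 : ∀ y : ℝ, 0 < y →
      Integrable (fun x : ℝ ↦ ‖cexp (-(I * t * (x + y * I))) * G (x + y * I)‖ ^ 2) := by
    intro y hy
    refine ((hint y hy).const_mul (Real.exp (y * t) ^ 2)).mono'
      ((hcont y hy).norm.pow 2).aestronglyMeasurable (Eventually.of_forall fun x ↦ ?_)
    rw [Real.norm_of_nonneg (sq_nonneg _)]
    exact hpt y hy x
  -- the uniform Hardy bound `2π‖f‖²`
  set M : ℝ := Real.sqrt (2 * Real.pi) * ‖f‖ with hM
  have hM0 : 0 ≤ M := by positivity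
  have hM2 : M ^ 2 = 2 * Real.pi * ‖f‖ ^ 2 := by
    rw [hM, mul_pow, Real.sq_sqrt Real.two_pi_pos.le]
  have hMb : ∀ y : ℝ, 0 < y →
      ∫ x : ℝ, ‖cexp (-(I * t * (x + y * I))) * G (x + y * I)‖ ^ 2 ≤ M ^ 2 := by
    intro y hy
    have hee : Real.exp (y * t) * Real.exp (-(y * t)) = 1 := by
      rw [← Real.exp_add, add_neg_cancel, Real.exp_zero]
    calc ∫ x : ℝ, ‖cexp (-(I * t * (x + y * I))) * G (x + y * I)‖ ^ 2
        ≤ ∫ x : ℝ, Real.exp (y * t) ^ 2 * ‖upperHalfHat f (x + y * I)‖ ^ 2 :=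
          integral_mono (h2 y hy) ((hint y hy).const_mul _) fun x ↦ hpt y hy x
      _ = Real.exp (y * t) ^ 2 * ∫ x : ℝ, ‖upperHalfHat f (x + y * I)‖ ^ 2 := integral_const_mul _ _
      _ ≤ Real.exp (y * t) ^ 2 * (2 * Real.pi * (Real.exp (-(y * t)) * ‖f‖) ^ 2) :=
          mul_le_mul_of_nonneg_left (integral_norm_sq_upperHalfHat_line_le hf hy) (sq_nonneg _)
      _ = M ^ 2 := by
          rw [hM2]
          calc Real.exp (y * t) ^ 2 * (2 * Real.pi * (Real.exp (-(y * t)) * ‖f‖) ^ 2)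
              = 2 * Real.pi * ‖f‖ ^ 2 * (Real.exp (y * t) * Real.exp (-(y * t))) ^ 2 := by ring
            _ = 2 * Real.pi * ‖f‖ ^ 2 := by rw [hee, one_pow, mul_one]
  obtain ⟨h, hh, hhat⟩ := exists_mem_halfLineL2_upperHalfHat_eq ht hM0 hd h2 hMb
  exact ⟨h, hh, fun z hz ↦ by rw [hhat z hz]⟩

/-! ## D. The Blaschke factor with pole in `ℂ₊` at a zero of `f̂` (Suzuki's `f_w`) -/

/-- **Suzuki's `f_w` (CJM Thm. 5.7, proof of (dB3)) via Paley–Wiener**: for `f ∈ L²(t,∞)`, `t ≥ 0`,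
`Im w > 0` and `f̂(w) = 0`, there is `h ∈ L²(t,∞)` with `ĥ(z) = (z − w̄)·dslope f̂ w z`
(`= ((z − w̄)/(z − w))f̂(z)` off `w`) on `ℂ₊`: the Hardy bound for `e^{−itz}(z − w̄)·dslope f̂ w z`
is obtained by splitting off a closed ball at `w` (where `dslope f̂ w` is bounded) and using
`|(z − w̄)/(z − w)| ≤ 5` outside it. RH-FREE.
[cite: Suzuki2025WeilHilbertSpace, CJM Thm. 5.7 p. 16, proof of (dB3) (TeX l.1928–1934: "f_w ∈ L²(t,∞) and (𝖥f_w)(z) = ((z−w̄)/(z−w))(𝖥f)(z)")] -/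
theorem exists_mem_halfLineL2_upperHalfHat_eq_blaschke_mul_of_im_pos
    {f : Lp ℂ 2 (volume : Measure ℝ)} {t : ℝ} (ht : 0 ≤ t) (hf : f ∈ halfLineL2 t)
    {w : ℂ} (hw : 0 < w.im) (hfw : upperHalfHat f w = 0) :
    ∃ h : Lp ℂ 2 (volume : Measure ℝ), h ∈ halfLineL2 t ∧
      ∀ z : ℂ, 0 < z.im → upperHalfHat h z = (z - conj w) * dslope (upperHalfHat f) w z := by
  set F : ℂ → ℂ := upperHalfHat f with hFdef
  set G : ℂ → ℂ := fun z ↦ (z - conj w) * dslope F w z with hG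
  have hU : IsOpen {z : ℂ | 0 < z.im} := isOpen_lt continuous_const Complex.continuous_im
  have hFd : DifferentiableOn ℂ F {z : ℂ | 0 < z.im} := differentiableOn_upperHalfHat f
  have hDd : DifferentiableOn ℂ (dslope F w) {z : ℂ | 0 < z.im} :=
    (Complex.differentiableOn_dslope (hU.mem_nhds hw)).2 hFd
  have hd : DifferentiableOn ℂ G {z : ℂ | 0 < z.im} :=
    (differentiable_id.sub (differentiable_const _)).differentiableOn.mul hDd
  set G' : ℂ → ℂ := fun z ↦ cexp (-(I * t * z)) * G z with hG'
  have hd' : DifferentiableOn ℂ G' {z : ℂ | 0 < z.im} :=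
    ((differentiable_const _).mul differentiable_id).neg.cexp.differentiableOn.mul hd
  have him : ∀ (x y : ℝ), 0 < y → 0 < ((x : ℂ) + y * I).im := fun x y hy ↦ by simp [hy]
  -- the ball around `w`
  set r : ℝ := w.im / 2 with hr
  have hr0 : 0 < r := by positivity
  have hwim : w.im = 2 * r := by rw [hr]; ring
  have hKU : closedBall w r ⊆ {z : ℂ | 0 < z.im} := by
    intro z hz
    have h1 : |(z - w).im| ≤ ‖z - w‖ := Complex.abs_im_le_norm (z - w)
    have h2 : ‖z - w‖ ≤ r := mem_closedBall_iff_norm.1 hz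
    rw [Complex.sub_im, abs_le] at h1
    show 0 < z.im
    linarith [h1.1]
  obtain ⟨S, hS⟩ := (isCompact_closedBall w r).exists_bound_of_continuousOn
    (hDd.continuousOn.mono hKU)
  have hS0 : 0 ≤ S := (norm_nonneg _).trans (hS w (mem_closedBall_self hr0.le))
  set C₀ : ℝ := Real.exp (6 * t * r) * (5 * r * S) ^ 2 with hC₀
  have hC₀0 : 0 ≤ C₀ := by positivity
  set Iw : Set ℝ := Icc (w.re - r) (w.re + r) with hIw
  -- the norm of `w − w̄`
  have hwc : ‖w - conj w‖ = 4 * r := by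
    have e : w - conj w = ((2 * w.im : ℝ) : ℂ) * I := by
      apply Complex.ext <;> simp [two_mul]
    rw [e, norm_mul, Complex.norm_I, mul_one, Complex.norm_real, Real.norm_eq_abs, abs_mul,
      abs_two, abs_of_pos hw, hwim]
    ring
  -- pointwise majorant on horizontal lines
  have hpt : ∀ y : ℝ, 0 < y → ∀ x : ℝ,
      ‖cexp (-(I * t * (x + y * I))) * G (x + y * I)‖ ^ 2 ≤
        25 * (Real.exp (y * t) ^ 2 * ‖F (x + y * I)‖ ^ 2) + Iw.indicator (fun _ ↦ C₀) x := by
    intro y hy x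
    have hexp : ‖cexp (-(I * t * ((x : ℂ) + y * I)))‖ = Real.exp (y * t) := by
      rw [Complex.norm_exp]
      congr 1
      simp only [Complex.neg_re, Complex.mul_re, Complex.mul_im, Complex.I_re, Complex.I_im,
        Complex.ofReal_re, Complex.ofReal_im, Complex.add_re, Complex.add_im]
      ring
    rw [norm_mul, mul_pow, hexp]
    have hind : 0 ≤ Iw.indicator (fun _ ↦ C₀) x := Set.indicator_nonneg (fun _ _ ↦ hC₀0) x
    by_cases hzK : ((x : ℂ) + y * I) ∈ closedBall w r
    · -- near `w`: `e^{2yt}‖G‖² ≤ C₀`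
      have hn : ‖((x : ℂ) + y * I) - w‖ ≤ r := mem_closedBall_iff_norm.1 hzK
      have hxI : x ∈ Iw := by
        have h1 : |(((x : ℂ) + y * I) - w).re| ≤ ‖((x : ℂ) + y * I) - w‖ :=
          Complex.abs_re_le_norm _
        have hre : (((x : ℂ) + y * I) - w).re = x - w.re := by simp
        rw [hre, abs_le] at h1
        rw [hIw, mem_Icc]
        constructor <;> linarith [h1.1, h1.2]
      rw [Set.indicator_of_mem hxI]
      have hy3 : y ≤ 3 * r := by
        have h1 : |(((x : ℂ) + y * I) - w).im| ≤ ‖((x : ℂ) + y * I) - w‖ :=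
          Complex.abs_im_le_norm _
        have hime : (((x : ℂ) + y * I) - w).im = y - w.im := by simp
        rw [hime, hwim, abs_le] at h1
        linarith [h1.2]
      have hG1 : ‖G ((x : ℂ) + y * I)‖ ≤ 5 * r * S := by
        rw [hG]
        simp only
        rw [norm_mul]
        have h1 : ‖(x : ℂ) + y * I - conj w‖ ≤ 5 * r := by
          have e : (x : ℂ) + y * I - conj w = ((x : ℂ) + y * I - w) + (w - conj w) := by ring
          calc ‖(x : ℂ) + y * I - conj w‖ ≤ ‖(x : ℂ) + y * I - w‖ + ‖w - conj w‖ := by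
                rw [e]; exact norm_add_le _ _
            _ ≤ r + 4 * r := add_le_add hn hwc.le
            _ = 5 * r := by ring
        exact mul_le_mul h1 (hS _ hzK) (norm_nonneg _) (by positivity)
      have h2 : Real.exp (y * t) ^ 2 ≤ Real.exp (6 * t * r) := by
        rw [← Real.exp_nat_mul]
        exact Real.exp_le_exp.2 (by push_cast; nlinarith)
      have h3 : ‖G ((x : ℂ) + y * I)‖ ^ 2 ≤ (5 * r * S) ^ 2 :=
        pow_le_pow_left₀ (norm_nonneg _) hG1 2
      have h4 : Real.exp (y * t) ^ 2 * ‖G ((x : ℂ) + y * I)‖ ^ 2 ≤ C₀ :=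
        mul_le_mul h2 h3 (sq_nonneg _) (Real.exp_pos _).le
      have h5 : 0 ≤ 25 * (Real.exp (y * t) ^ 2 * ‖F ((x : ℂ) + y * I)‖ ^ 2) := by positivity
      linarith
    · -- away from `w`: `|(z − w̄)/(z − w)| ≤ 5`
      have hzw : r < ‖((x : ℂ) + y * I) - w‖ := by
        rw [mem_closedBall_iff_norm, not_le] at hzK; exact hzK
      have hzw' : ((x : ℂ) + y * I) ≠ w := by
        intro h; rw [h, sub_self, norm_zero] at hzw; exact absurd hzw (not_lt.2 hr0.le)
      have hGeq : G ((x : ℂ) + y * I) =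
          (((x : ℂ) + y * I) - conj w) / (((x : ℂ) + y * I) - w) * F ((x : ℂ) + y * I) :=
        blaschke_dslope_apply_of_ne hfw hzw'
      have hB5 : ‖(((x : ℂ) + y * I) - conj w) / (((x : ℂ) + y * I) - w)‖ ≤ 5 := by
        rw [norm_div, div_le_iff₀ (hr0.trans hzw)]
        have e : (x : ℂ) + y * I - conj w = ((x : ℂ) + y * I - w) + (w - conj w) := by ring
        calc ‖(x : ℂ) + y * I - conj w‖ ≤ ‖(x : ℂ) + y * I - w‖ + ‖w - conj w‖ := by
              rw [e]; exact norm_add_le _ _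
          _ = ‖(x : ℂ) + y * I - w‖ + 4 * r := by rw [hwc]
          _ ≤ 5 * ‖(x : ℂ) + y * I - w‖ := by linarith
      have hGz : ‖G ((x : ℂ) + y * I)‖ ^ 2 ≤ 25 * ‖F ((x : ℂ) + y * I)‖ ^ 2 := by
        rw [hGeq, norm_mul, mul_pow]
        have : ‖(((x : ℂ) + y * I) - conj w) / (((x : ℂ) + y * I) - w)‖ ^ 2 ≤ 25 := by
          nlinarith [norm_nonneg ((((x : ℂ) + y * I) - conj w) / (((x : ℂ) + y * I) - w))]
        exact mul_le_mul_of_nonneg_right this (sq_nonneg _)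
      calc Real.exp (y * t) ^ 2 * ‖G ((x : ℂ) + y * I)‖ ^ 2
          ≤ Real.exp (y * t) ^ 2 * (25 * ‖F ((x : ℂ) + y * I)‖ ^ 2) :=
            mul_le_mul_of_nonneg_left hGz (sq_nonneg _)
        _ = 25 * (Real.exp (y * t) ^ 2 * ‖F ((x : ℂ) + y * I)‖ ^ 2) := by ring
        _ ≤ _ := le_add_of_nonneg_right hind
  -- integrability on horizontal lines
  have hcont : ∀ y : ℝ, 0 < y →
      Continuous fun x : ℝ ↦ cexp (-(I * t * (x + y * I))) * G (x + y * I) := by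
    intro y hy
    have hline : Continuous fun x : ℝ ↦ ((x : ℂ) + y * I) := by fun_prop
    exact hd'.continuousOn.comp_continuous hline fun x ↦ him x y hy
  have hint : ∀ y : ℝ, 0 < y → Integrable fun x : ℝ ↦ ‖F (x + y * I)‖ ^ 2 :=
    fun y hy ↦ (memLp_two_iff_integrable_sq_norm (memLp_upperHalfHat_line f hy).1).1
      (memLp_upperHalfHat_line f hy)
  have hIint : Integrable (Iw.indicator fun _ : ℝ ↦ C₀) volume :=
    (integrable_indicator_iff measurableSet_Icc).2
      (continuousOn_const.integrableOn_compact isCompact_Icc)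
  have hmaj : ∀ y : ℝ, 0 < y → Integrable fun x : ℝ ↦
      25 * (Real.exp (y * t) ^ 2 * ‖F (x + y * I)‖ ^ 2) + Iw.indicator (fun _ ↦ C₀) x :=
    fun y hy ↦ (((hint y hy).const_mul _).const_mul _).add hIint
  have h2 : ∀ y : ℝ, 0 < y →
      Integrable (fun x : ℝ ↦ ‖cexp (-(I * t * (x + y * I))) * G (x + y * I)‖ ^ 2) := by
    intro y hy
    refine (hmaj y hy).mono' ((hcont y hy).norm.pow 2).aestronglyMeasurable
      (Eventually.of_forall fun x ↦ ?_)
    rw [Real.norm_of_nonneg (sq_nonneg _)]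
    exact hpt y hy x
  -- the uniform Hardy bound
  set M : ℝ := Real.sqrt (25 * (2 * Real.pi * ‖f‖ ^ 2) + 2 * r * C₀) with hM
  have hM0 : 0 ≤ M := Real.sqrt_nonneg _
  have hM2 : M ^ 2 = 25 * (2 * Real.pi * ‖f‖ ^ 2) + 2 * r * C₀ := Real.sq_sqrt (by positivity)
  have hMb : ∀ y : ℝ, 0 < y →
      ∫ x : ℝ, ‖cexp (-(I * t * (x + y * I))) * G (x + y * I)‖ ^ 2 ≤ M ^ 2 := by
    intro y hy
    have hee : Real.exp (y * t) * Real.exp (-(y * t)) = 1 := by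
      rw [← Real.exp_add, add_neg_cancel, Real.exp_zero]
    have hA : Real.exp (y * t) ^ 2 * ∫ x : ℝ, ‖F (x + y * I)‖ ^ 2 ≤ 2 * Real.pi * ‖f‖ ^ 2 := by
      calc Real.exp (y * t) ^ 2 * ∫ x : ℝ, ‖F (x + y * I)‖ ^ 2
          ≤ Real.exp (y * t) ^ 2 * (2 * Real.pi * (Real.exp (-(y * t)) * ‖f‖) ^ 2) :=
            mul_le_mul_of_nonneg_left (integral_norm_sq_upperHalfHat_line_le hf hy) (sq_nonneg _)
        _ = 2 * Real.pi * ‖f‖ ^ 2 * (Real.exp (y * t) * Real.exp (-(y * t))) ^ 2 := by ring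
        _ = 2 * Real.pi * ‖f‖ ^ 2 := by rw [hee, one_pow, mul_one]
    have hB : ∫ x : ℝ, Iw.indicator (fun _ ↦ C₀) x = 2 * r * C₀ := by
      rw [integral_indicator_const C₀ measurableSet_Icc, smul_eq_mul,
        Real.volume_real_Icc_of_le (by linarith)]
      ring
    calc ∫ x : ℝ, ‖cexp (-(I * t * (x + y * I))) * G (x + y * I)‖ ^ 2
        ≤ ∫ x : ℝ, (25 * (Real.exp (y * t) ^ 2 * ‖F (x + y * I)‖ ^ 2) +
            Iw.indicator (fun _ ↦ C₀) x) := integral_mono (h2 y hy) (hmaj y hy) (hpt y hy)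
      _ = 25 * (Real.exp (y * t) ^ 2 * ∫ x : ℝ, ‖F (x + y * I)‖ ^ 2) + 2 * r * C₀ := by
          rw [integral_add (((hint y hy).const_mul _).const_mul _) hIint, integral_const_mul,
            integral_const_mul, hB]
      _ ≤ 25 * (2 * Real.pi * ‖f‖ ^ 2) + 2 * r * C₀ := by linarith [hA]
      _ = M ^ 2 := hM2.symm
  obtain ⟨h, hh, hhat⟩ := exists_mem_halfLineL2_upperHalfHat_eq ht hM0 hd h2 hMb
  exact ⟨h, hh, fun z hz ↦ by rw [hhat z hz]⟩

end Literature.NumberTheory.LFunctions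

end
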